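import Mathlib.Analysis.Calculus.Deriv.Shift
import Mathlib.MeasureTheory.Function.Floor
import Literature.Analysis.FluidPDE.KNSSRegularity
import Literature.Analysis.FluidPDE.TaoEnstrophyLocalisation
import HarnessLib

/-!
# KNSS 2009, §4: from finite windows to `(−∞, 0)` — translation and gluing tools

Analysis/FluidPDE proofs file on the discharge path of the named fact
`Literature.Analysis.FluidPDE.KNSS2009_regularity_boundedWeak_ancient` (`KNSSRegularity`;
Koch–Nadirashvili–Seregin–Šverák, Acta Math. 203 (2009) = arXiv:0709.3599, §4 as consumed by the
proof of Theorem 5.2: "By the results of Section 4, we have `|∇ᵏₓu| ≤ C_k` in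
`ℝ³ × (−∞, 0)`"). Section 4 is printed for bounded weak solutions on a finite window
`ℝⁿ × (0, T)` with constants `C(k, δ, T, M)` on `(δ, T)` (vendored as the named fact
`KNSS2009_regularity_boundedWeak_window`, file `KNSSRegularityWindow`); the ancient form is
obtained from it by

1. **time translation** of the class of bounded weak solutions
   (`IsBoundedWeakNSSolutionOn.comp_add_right`, proved here: measurability and the bound move
   along the measure-preserving translation of the slab, and a divergence-free test field `ψ`
   on `(I − c) × E` is tested against `u(· + c)` by testing `ψ(· − c)` against `u`);
2. applying the window statement on the windows `W_j = (−j − 4, −j)`, `j ∈ ℕ`, with `δ = 1`, so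
   that the "good ranges" `G_j = (−j − 3, −j)` carry uniform bounds, and
3. **gluing** the windowed decompositions `u = U_j + b_j(t)` along a selection `ι : ℝ → ℕ` of
   pieces (`t ∈ [−ι(t) − 1, −ι(t)) ⊆ G_{ι(t)}`): `U(t) = U_{ι(t)}(t)`, `b(t) = b_{ι(t)}(t)`.

This file proves the gluing lemmas for step 3 that do not need the window fact itself, for
arbitrary families `(U_j, b_j)` satisfying the windowed clauses:

* `measurable_glue`, `measurable_uncurry_glue` — measurable selections from sequences of
  (jointly) measurable functions;
* `ae_eq_glue` — the a.e. identity `u(t) = U(t) + b(t)`;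
* `ae_overlap_apply_eq`, `overlap_sub_eq` — **overlap agreement**: on `G_j ∩ G_{j'}`,
  `U_j(t, ·) − U_{j'}(t, ·)` is constant in `x` for *every* `t` (a.e. in `t` because both
  `U_j + b_j` and `U_{j'} + b_{j'}` are a.e. equal to `u(t)` and continuous in `x`; for every `t`
  by continuity in `t`, `Measure.eqOn_open_of_ae_eq`) — this is Remark 3.1 of the source ("`w`
  and `b` are determined up to a constant") in the form the gluing needs;
* `overlap_fderiv_eq`, `overlap_curl_eq`, `overlap_iteratedFDeriv_succ_eq` — hence all spatial
  derivatives of order `≥ 1`, and the vorticity, are intrinsic;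
* `glue_pointwise`, `glue_lipschitz` — smoothness, `div U = 0`, the bounds, and the global
  Lipschitz-in-time bound for derivatives of order `≥ 1` (nearby times share a good range;
  distant times are covered by the uniform bound);
* calculus plumbing (`norm_iteratedFDeriv_fderiv_sub`, `continuousOn_*_family`): for a family
  `V(t, ·)` of smooth fields whose derivatives of every order are Lipschitz in `t`, the maps
  `t ↦ DV(t)(x)`, `curl V(t)(x)`, `D(curl V(t))(x)`, `Δ(curl V(t))(x)` are continuous (used for
  the integrability of the vorticity integrand in `KNSSRegularityAncient`).

The vorticity identity of the glued field and the final assembly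
`KNSS2009_regularity_boundedWeak_ancient_of_window` are in `KNSSRegularityAncient`.

## References

* G. Koch, N. Nadirashvili, G. Seregin, V. Šverák, *Liouville theorems for the Navier–Stokes
  equations and applications*, Acta Math. 203 (2009) 83–105 = arXiv:0709.3599v1: §3 Lemma 3.1
  and Remark 3.1; §4 (4.7)–(4.11); §5, proof of Theorem 5.2, first sentence.
  [KochNadirashviliSereginSverak2009]
-/

noncomputable section

open MeasureTheory Set Function Filter TopologicalSpace InnerProductSpace
open scoped RealInnerProductSpace Laplacian ContDiff NNReal

namespace Literature.Analysis.FluidPDE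

/-! ### Time translation of bounded weak solutions -/

section Translate

variable {E : Type*} [NormedAddCommGroup E] [InnerProductSpace ℝ E] [FiniteDimensional ℝ E]
  [MeasurableSpace E] [BorelSpace E]

/-- **Time translation of bounded weak solutions** (KNSS 2009, §4: the class of bounded weak
solutions on `ℝⁿ × I` is invariant under `t ↦ t + c`; used tacitly when "the results of
Section 4", written on `(0, T)`, are applied on `(−∞, 0)` in the proof of Theorem 5.2). If `u`
is a bounded weak solution on the open time set `I`, then `t ↦ u(t + c)` is one on
`J = I − c`: measurability and the bound transport along the measure-preserving translation,
and a divergence-free test field `ψ` on `J × E` is tested against `u(· + c)` by testing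
`ψ(· − c)` against `u` and changing variables in the time integral. [folklore] -/
theorem IsBoundedWeakNSSolutionOn.comp_add_right {I : Set ℝ} {hI : IsOpen I} {ν : ℝ}
    {u : ℝ → E → E} (h : IsBoundedWeakNSSolutionOn I hI ν u) (c : ℝ) {J : Set ℝ}
    (hJ : IsOpen J) (hJI : ∀ t, t ∈ J ↔ t + c ∈ I) :
    IsBoundedWeakNSSolutionOn J hJ ν (fun t => u (t + c)) := by
  obtain ⟨hmeas, ⟨C, hC⟩, hdiv, hweak⟩ := h
  have hJeq : J = (fun t => t + c) ⁻¹' I := Set.ext fun t => by simpa using hJI t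
  refine ⟨?_, ⟨C, fun t ht x => hC (t + c) ((hJI t).1 ht) x⟩, ?_, fun ψ hψ hψdiv => ?_⟩
  · -- measurability on the slab, along `(t, x) ↦ (t + c, x)`
    have he : MeasurePreserving (Prod.map (fun t : ℝ => t + c) (id : E → E))
        (volume : Measure (ℝ × E)) volume := by
      have := (measurePreserving_add_right (volume : Measure ℝ) c).prod
        (MeasurePreserving.id (volume : Measure E))
      rwa [← Measure.volume_eq_prod] at this
    have hpre : (Prod.map (fun t : ℝ => t + c) (id : E → E)) ⁻¹' (I ×ˢ (univ : Set E)) =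
        J ×ˢ univ := by
      ext p
      simp [hJI]
    have he' := he.restrict_preimage (hI.measurableSet.prod MeasurableSet.univ)
    rw [hpre] at he'
    exact hmeas.comp_measurePreserving he'
  · -- divergence constraint for a.e. time
    rw [ae_restrict_iff' hI.measurableSet] at hdiv
    rw [ae_restrict_iff' hJ.measurableSet]
    have h2 := (measurePreserving_add_right (volume : Measure ℝ) c).quasiMeasurePreserving.ae
      hdiv
    filter_upwards [h2] with t ht htJ
    exact ht ((hJI t).1 htJ)
  · -- the weak identity: test `ψ(· − c)` against `u`
    set φ : ℝ → E → E := fun t => ψ (t - c) with hφ_def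
    let e : ℝ × E ≃ₜ ℝ × E := (Homeomorph.subRight c).prodCongr (Homeomorph.refl E)
    have hcomp : uncurry φ = uncurry ψ ∘ e := by
      funext p
      rfl
    have hφ : IsSpaceTimeTestOn (slab E I hI) φ := by
      refine ⟨?_, ?_, ?_⟩
      · rw [hcomp]
        exact hψ.contDiff.comp
          ((contDiff_fst.sub contDiff_const).prodMk contDiff_snd)
      · rw [hcomp]
        exact hψ.hasCompactSupport.comp_homeomorph e
      · rw [hcomp]
        intro p hp
        have hp' : e p ∈ tsupport (uncurry ψ) := by
          rw [tsupport, Function.support_comp_eq_preimage, ← e.preimage_closure] at hp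
          exact hp
        have h1 := hψ.tsupport_subset hp'
        rw [SetLike.mem_coe, mem_slab] at h1 ⊢
        have h2 : (e p).1 = p.1 - c := rfl
        rw [h2] at h1
        have := (hJI (p.1 - c)).1 h1
        simpa using this
    have hφdiv : ∀ t, VectorCalculus.IsDivFree (φ t) := fun t => hψdiv (t - c)
    have key := hweak φ hφ hφdiv
    -- the integrand at time `t + c` for `φ` is the integrand at time `t` for `ψ`
    set G : ℝ → ℝ := fun t => ∫ x, (⟪u t x, timeDeriv φ t x⟫ + ⟪u t x, convect (u t) (φ t) x⟫ +
      ν * ⟪u t x, Δ (φ t) x⟫) with hG_def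
    have hφt : ∀ t, φ (t + c) = ψ t := fun t => by simp [hφ_def]
    have htd : ∀ t x, timeDeriv φ (t + c) x = timeDeriv ψ t x := by
      intro t x
      simp only [timeDeriv_apply, hφ_def]
      rw [deriv_comp_sub_const (f := fun s => ψ s x), add_sub_cancel_right]
    have hGt : ∀ t, G (t + c) = ∫ x, (⟪u (t + c) x, timeDeriv ψ t x⟫ +
        ⟪u (t + c) x, convect (u (t + c)) (ψ t) x⟫ + ν * ⟪u (t + c) x, Δ (ψ t) x⟫) := by
      intro t
      simp only [hG_def, htd, hφt]
    calc ∫ t in J, ∫ x, (⟪u (t + c) x, timeDeriv ψ t x⟫ +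
          ⟪u (t + c) x, convect (u (t + c)) (ψ t) x⟫ + ν * ⟪u (t + c) x, Δ (ψ t) x⟫)
        = ∫ t in J, G (t + c) := by simp only [hGt]
      _ = ∫ t in I, G t := by
          rw [hJeq]
          exact (measurePreserving_add_right (volume : Measure ℝ) c).setIntegral_preimage_emb
            (measurableEmbedding_addRight c) G I
      _ = 0 := key

end Translate

/-! ### Calculus plumbing: families of smooth fields whose derivatives are Lipschitz in time -/

section Plumbing

variable {E' F : Type*} [NormedAddCommGroup E'] [NormedSpace ℝ E'] [NormedAddCommGroup F]
  [NormedSpace ℝ F]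

/-- `‖f x − g x‖ = ‖D⁰f(x) − D⁰g(x)‖` (the `0`-th iterated derivative is the function, through
the currying isometry). [folklore] -/
theorem norm_sub_eq_norm_iteratedFDeriv_zero_sub (f g : E' → F) (x : E') :
    ‖f x - g x‖ = ‖iteratedFDeriv ℝ 0 f x - iteratedFDeriv ℝ 0 g x‖ := by
  rw [iteratedFDeriv_zero_eq_comp, iteratedFDeriv_zero_eq_comp, Function.comp_apply,
    Function.comp_apply, ← map_sub, LinearIsometryEquiv.norm_map]

/-- `‖Dⁿ(Df)(x) − Dⁿ(Dg)(x)‖ = ‖Dⁿ⁺¹f(x) − Dⁿ⁺¹g(x)‖` (currying isometry). [folklore] -/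
theorem norm_iteratedFDeriv_fderiv_sub (f g : E' → F) (x : E') (n : ℕ) :
    ‖iteratedFDeriv ℝ n (fderiv ℝ f) x - iteratedFDeriv ℝ n (fderiv ℝ g) x‖ =
      ‖iteratedFDeriv ℝ (n + 1) f x - iteratedFDeriv ℝ (n + 1) g x‖ := by
  rw [iteratedFDeriv_succ_eq_comp_right, iteratedFDeriv_succ_eq_comp_right, Function.comp_apply,
    Function.comp_apply, ← LinearIsometryEquiv.map_sub, LinearIsometryEquiv.norm_map]

omit [NormedSpace ℝ F] in
/-- A function `f : ℝ → F` with `‖f t − f s‖ ≤ L |t − s|` on `S` is continuous on `S`. [folklore] -/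
theorem continuousOn_of_norm_sub_le_mul {f : ℝ → F} {S : Set ℝ} {L : ℝ}
    (h : ∀ s ∈ S, ∀ t ∈ S, ‖f t - f s‖ ≤ L * |t - s|) : ContinuousOn f S := by
  have : LipschitzOnWith (Real.toNNReal L) f S := by
    refine LipschitzOnWith.of_dist_le' fun t ht s hs => ?_
    rw [dist_eq_norm, Real.dist_eq]
    exact h s hs t ht
  exact this.continuousOn

/-- If all spatial derivatives of a family `V(t, ·)` are Lipschitz in `t` on `S` (constants
`L k`), the same holds for the family of gradients `DV(t, ·)`, with constants `L (k + 1)`. [folklore] -/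
theorem lipschitz_family_fderiv {V : ℝ → E' → F} {S : Set ℝ} {L : ℕ → ℝ}
    (h : ∀ k : ℕ, ∀ s ∈ S, ∀ t ∈ S, ∀ x,
      ‖iteratedFDeriv ℝ k (V t) x - iteratedFDeriv ℝ k (V s) x‖ ≤ L k * |t - s|) :
    ∀ k : ℕ, ∀ s ∈ S, ∀ t ∈ S, ∀ x,
      ‖iteratedFDeriv ℝ k (fderiv ℝ (V t)) x - iteratedFDeriv ℝ k (fderiv ℝ (V s)) x‖ ≤
        L (k + 1) * |t - s| := by
  intro k s hs t ht x
  rw [norm_iteratedFDeriv_fderiv_sub]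
  exact h (k + 1) s hs t ht x

/-- Under the same hypothesis, `t ↦ DᵏV(t, ·)(x)` is continuous on `S` for every `k`, `x`. [folklore] -/
theorem continuousOn_iteratedFDeriv_family {V : ℝ → E' → F} {S : Set ℝ} {L : ℕ → ℝ}
    (h : ∀ k : ℕ, ∀ s ∈ S, ∀ t ∈ S, ∀ x,
      ‖iteratedFDeriv ℝ k (V t) x - iteratedFDeriv ℝ k (V s) x‖ ≤ L k * |t - s|)
    (k : ℕ) (x : E') : ContinuousOn (fun t => iteratedFDeriv ℝ k (V t) x) S :=
  continuousOn_of_norm_sub_le_mul fun s hs t ht => h k s hs t ht x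

/-- Under the same hypothesis, `t ↦ V(t, x)` is continuous on `S` (order `0`). [folklore] -/
theorem continuousOn_apply_family {V : ℝ → E' → F} {S : Set ℝ} {L : ℕ → ℝ}
    (h : ∀ k : ℕ, ∀ s ∈ S, ∀ t ∈ S, ∀ x,
      ‖iteratedFDeriv ℝ k (V t) x - iteratedFDeriv ℝ k (V s) x‖ ≤ L k * |t - s|)
    (x : E') : ContinuousOn (fun t => V t x) S :=
  continuousOn_of_norm_sub_le_mul fun s hs t ht => by
    rw [norm_sub_eq_norm_iteratedFDeriv_zero_sub]
    exact h 0 s hs t ht x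

/-- Under the same hypothesis, `t ↦ DV(t, ·)(x)` is continuous on `S`. [folklore] -/
theorem continuousOn_fderiv_family {V : ℝ → E' → F} {S : Set ℝ} {L : ℕ → ℝ}
    (h : ∀ k : ℕ, ∀ s ∈ S, ∀ t ∈ S, ∀ x,
      ‖iteratedFDeriv ℝ k (V t) x - iteratedFDeriv ℝ k (V s) x‖ ≤ L k * |t - s|)
    (x : E') : ContinuousOn (fun t => fderiv ℝ (V t) x) S :=
  continuousOn_apply_family (lipschitz_family_fderiv h) x

end Plumbing

section Plumbing3

/-- For a family of smooth fields on `ℝ³` whose spatial derivatives are Lipschitz in time on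
`S`, the vorticity `t ↦ curl V(t, ·)(x)` is continuous on `S`. [folklore] -/
theorem continuousOn_curl_family {V : ℝ → EuclideanSpace ℝ (Fin 3) → EuclideanSpace ℝ (Fin 3)}
    {S : Set ℝ} {L : ℕ → ℝ}
    (h : ∀ k : ℕ, ∀ s ∈ S, ∀ t ∈ S, ∀ x,
      ‖iteratedFDeriv ℝ k (V t) x - iteratedFDeriv ℝ k (V s) x‖ ≤ L k * |t - s|)
    (x : EuclideanSpace ℝ (Fin 3)) : ContinuousOn (fun t => curl (V t) x) S := by
  simp_rw [curl_eq_curlCLM]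
  exact curlCLM.continuous.comp_continuousOn (continuousOn_fderiv_family h x)

/-- Same family: the vorticity gradient `t ↦ D(curl V(t, ·))(x)` is continuous on `S`. [folklore] -/
theorem continuousOn_fderiv_curl_family
    {V : ℝ → EuclideanSpace ℝ (Fin 3) → EuclideanSpace ℝ (Fin 3)} {S : Set ℝ} {L : ℕ → ℝ}
    (hV : ∀ t ∈ S, ContDiff ℝ ∞ (V t))
    (h : ∀ k : ℕ, ∀ s ∈ S, ∀ t ∈ S, ∀ x,
      ‖iteratedFDeriv ℝ k (V t) x - iteratedFDeriv ℝ k (V s) x‖ ≤ L k * |t - s|)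
    (x : EuclideanSpace ℝ (Fin 3)) : ContinuousOn (fun t => fderiv ℝ (curl (V t)) x) S := by
  have h2 : ContinuousOn (fun t => fderiv ℝ (fderiv ℝ (V t)) x) S :=
    continuousOn_apply_family (lipschitz_family_fderiv (lipschitz_family_fderiv h)) x
  have h3 : ContinuousOn (fun t => curlCLM.comp (fderiv ℝ (fderiv ℝ (V t)) x)) S :=
    continuousOn_const.clm_comp h2
  refine h3.congr fun t ht => ?_
  have h2t : ContDiff ℝ 2 (V t) := contDiff_infty.1 (hV t ht) 2
  exact fderiv_curl h2t x

/-- Same family: `t ↦ Δ(curl V(t, ·))(x)` is continuous on `S` (the Laplacian is a fixed linear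
function of the second derivative, `laplacian_eq_iteratedFDeriv_stdOrthonormalBasis`). [folklore] -/
theorem continuousOn_laplacian_curl_family
    {V : ℝ → EuclideanSpace ℝ (Fin 3) → EuclideanSpace ℝ (Fin 3)} {S : Set ℝ} {L : ℕ → ℝ}
    (hV : ∀ t ∈ S, ContDiff ℝ ∞ (V t))
    (h : ∀ k : ℕ, ∀ s ∈ S, ∀ t ∈ S, ∀ x,
      ‖iteratedFDeriv ℝ k (V t) x - iteratedFDeriv ℝ k (V s) x‖ ≤ L k * |t - s|)
    (x : EuclideanSpace ℝ (Fin 3)) : ContinuousOn (fun t => Δ (curl (V t)) x) S := by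
  set b := stdOrthonormalBasis ℝ (EuclideanSpace ℝ (Fin 3)) with hb
  have h3 : ContinuousOn (fun t => iteratedFDeriv ℝ 2 (fderiv ℝ (V t)) x) S :=
    continuousOn_iteratedFDeriv_family (lipschitz_family_fderiv h) 2 x
  have hsum : ContinuousOn
      (fun t => ∑ i, iteratedFDeriv ℝ 2 (fderiv ℝ (V t)) x ![b i, b i]) S :=
    continuousOn_finsetSum _ fun i _ =>
      (continuous_eval_const (![b i, b i] : Fin 2 → EuclideanSpace ℝ (Fin 3))).comp_continuousOn h3
  have hc : ContinuousOn
      (fun t => curlCLM (∑ i, iteratedFDeriv ℝ 2 (fderiv ℝ (V t)) x ![b i, b i])) S :=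
    curlCLM.continuous.comp_continuousOn hsum
  refine hc.congr fun t ht => ?_
  have h3t : ContDiff ℝ 3 (V t) := contDiff_infty.1 (hV t ht) 3
  have hft : ContDiff ℝ 2 (fderiv ℝ (V t)) := h3t.fderiv_right (m := 2) (by norm_num)
  show Δ (curl (V t)) x = curlCLM (∑ i, iteratedFDeriv ℝ 2 (fderiv ℝ (V t)) x ![b i, b i])
  rw [curl_eq_curlCLM_comp, ContDiffAt.laplacian_CLM_comp_left hft.contDiffAt,
    Function.comp_apply, laplacian_eq_iteratedFDeriv_stdOrthonormalBasis]

end Plumbing3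

/-! ### Gluing windowed decompositions on `(−∞, 0)` -/

section Gluing

variable {u : ℝ → EuclideanSpace ℝ (Fin 3) → EuclideanSpace ℝ (Fin 3)}
  {Uw : ℕ → ℝ → EuclideanSpace ℝ (Fin 3) → EuclideanSpace ℝ (Fin 3)}
  {bw : ℕ → ℝ → EuclideanSpace ℝ (Fin 3)} {ι : ℝ → ℕ}

/-- A measurable selection `t ↦ b_{ι(t)}(t)` from a sequence of measurable functions is
measurable. [folklore] -/
theorem measurable_glue (hbm : ∀ j, Measurable (bw j)) (hι : Measurable ι) :
    Measurable fun t => bw (ι t) t := by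
  have hF : Measurable fun p : ℝ × ℕ => bw p.2 p.1 :=
    measurable_from_prod_countable_left fun j => hbm j
  exact hF.comp (measurable_id.prodMk hι)

/-- A measurable selection `(t, x) ↦ U_{ι(t)}(t, x)` from a sequence of jointly measurable fields
is jointly measurable. [folklore] -/
theorem measurable_uncurry_glue (hUm : ∀ j, Measurable (uncurry (Uw j))) (hι : Measurable ι) :
    Measurable (uncurry fun t x => Uw (ι t) t x) := by
  have hF : Measurable fun p : (ℝ × EuclideanSpace ℝ (Fin 3)) × ℕ => uncurry (Uw p.2) p.1 :=
    measurable_from_prod_countable_left fun j => hUm j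
  have hG : Measurable fun q : ℝ × EuclideanSpace ℝ (Fin 3) => (q, ι q.1) :=
    measurable_id.prodMk (hι.comp measurable_fst)
  exact hF.comp hG

/-- If `u = U_j + b_j` a.e. on each window `(−j − 4, −j) × ℝ³` and `ι` selects, for `t < 0`, a
window with `t ∈ [−ι(t) − 1, −ι(t))`, then `u = U_{ι(t)}(t) + b_{ι(t)}(t)` a.e., for a.e.
`t < 0`. [folklore] -/
theorem ae_eq_glue
    (hae : ∀ j : ℕ, ∀ᵐ t ∂((volume : Measure ℝ).restrict (Ioo (-(j : ℝ) - 4) (-(j : ℝ)))),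
      u t =ᵐ[volume] fun x => Uw j t x + bw j t)
    (hι : ∀ t < 0, -(ι t : ℝ) - 1 ≤ t ∧ t < -(ι t : ℝ)) :
    ∀ᵐ t ∂((volume : Measure ℝ).restrict (Iio 0)),
      u t =ᵐ[volume] fun x => Uw (ι t) t x + bw (ι t) t := by
  have hall : ∀ᵐ t ∂(volume : Measure ℝ), ∀ j : ℕ, t ∈ Ioo (-(j : ℝ) - 4) (-(j : ℝ)) →
      u t =ᵐ[volume] fun x => Uw j t x + bw j t := by
    rw [ae_all_iff]
    intro j
    exact (ae_restrict_iff' measurableSet_Ioo).1 (hae j)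
  rw [ae_restrict_iff' measurableSet_Iio]
  filter_upwards [hall] with t ht htneg
  obtain ⟨h1, h2⟩ := hι t htneg
  exact ht (ι t) ⟨by linarith, h2⟩

/-- On all pairs of windows at once: for a.e. `t`, if `t` lies in the windows `j` and `j'` then
`U_j(t, ·) + b_j(t) = U_{j'}(t, ·) + b_{j'}(t)` everywhere (both are a.e. equal to `u(t, ·)` and
continuous). [folklore] -/
theorem ae_overlap_apply_eq
    (hae : ∀ j : ℕ, ∀ᵐ t ∂((volume : Measure ℝ).restrict (Ioo (-(j : ℝ) - 4) (-(j : ℝ)))),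
      u t =ᵐ[volume] fun x => Uw j t x + bw j t)
    (hsm : ∀ j : ℕ, ∀ t ∈ Ioo (-(j : ℝ) - 4) (-(j : ℝ)), ContDiff ℝ ∞ (Uw j t)) :
    ∀ᵐ t ∂(volume : Measure ℝ), ∀ j j' : ℕ, t ∈ Ioo (-(j : ℝ) - 4) (-(j : ℝ)) →
      t ∈ Ioo (-(j' : ℝ) - 4) (-(j' : ℝ)) → ∀ x, Uw j t x + bw j t = Uw j' t x + bw j' t := by
  have hall : ∀ᵐ t ∂(volume : Measure ℝ), ∀ j : ℕ, t ∈ Ioo (-(j : ℝ) - 4) (-(j : ℝ)) →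
      u t =ᵐ[volume] fun x => Uw j t x + bw j t := by
    rw [ae_all_iff]
    intro j
    exact (ae_restrict_iff' measurableSet_Ioo).1 (hae j)
  filter_upwards [hall] with t ht j j' h1 h2 x
  have e := (ht j h1).symm.trans (ht j' h2)
  have hc : Continuous fun x => Uw j t x + bw j t := (hsm j t h1).continuous.add continuous_const
  have hc' : Continuous fun x => Uw j' t x + bw j' t :=
    (hsm j' t h2).continuous.add continuous_const
  exact congrFun (Measure.eq_of_ae_eq e hc hc') x

/-- **Overlap agreement up to constants.** On the common good range of two windows,
`U_j(t, ·) − U_{j'}(t, ·)` is constant in `x` for *every* `t`: it is for a.e. `t` by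
`ae_overlap_apply_eq`, and both fields are continuous in `t` (order-`0` Lipschitz bound). [folklore] -/
theorem overlap_sub_eq
    (hae : ∀ j : ℕ, ∀ᵐ t ∂((volume : Measure ℝ).restrict (Ioo (-(j : ℝ) - 4) (-(j : ℝ)))),
      u t =ᵐ[volume] fun x => Uw j t x + bw j t)
    (hsm : ∀ j : ℕ, ∀ t ∈ Ioo (-(j : ℝ) - 4) (-(j : ℝ)), ContDiff ℝ ∞ (Uw j t))
    {L : ℕ → ℝ}
    (hlip : ∀ (j k : ℕ), ∀ s ∈ Ioo (-(j : ℝ) - 3) (-(j : ℝ)), ∀ t ∈ Ioo (-(j : ℝ) - 3) (-(j : ℝ)), ∀ x,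
      ‖iteratedFDeriv ℝ k (Uw j t) x - iteratedFDeriv ℝ k (Uw j s) x‖ ≤ L k * |t - s|)
    {j j' : ℕ} {t : ℝ} (ht : t ∈ Ioo (-(j : ℝ) - 3) (-(j : ℝ)))
    (ht' : t ∈ Ioo (-(j' : ℝ) - 3) (-(j' : ℝ))) (x y : EuclideanSpace ℝ (Fin 3)) :
    Uw j t x - Uw j' t x = Uw j t y - Uw j' t y := by
  set S : Set ℝ := Ioo (-(j : ℝ) - 3) (-(j : ℝ)) ∩ Ioo (-(j' : ℝ) - 3) (-(j' : ℝ)) with hS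
  have hSo : IsOpen S := isOpen_Ioo.inter isOpen_Ioo
  have hsub : ∀ i : ℕ, Ioo (-(i : ℝ) - 3) (-(i : ℝ)) ⊆ Ioo (-(i : ℝ) - 4) (-(i : ℝ)) :=
    fun i τ hτ => ⟨by linarith [hτ.1], hτ.2⟩
  set f : ℝ → EuclideanSpace ℝ (Fin 3) :=
    fun τ => (Uw j τ x - Uw j' τ x) - (Uw j τ y - Uw j' τ y) with hf
  -- `f = 0` a.e. on `S`
  have hf0 : f =ᵐ[(volume : Measure ℝ).restrict S] fun _ => 0 := by
    rw [Filter.EventuallyEq, ae_restrict_iff' hSo.measurableSet]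
    filter_upwards [ae_overlap_apply_eq hae hsm] with τ hτ hτS
    have hx := hτ j j' (hsub j hτS.1) (hsub j' hτS.2) x
    have hy := hτ j j' (hsub j hτS.1) (hsub j' hτS.2) y
    have hx' := eq_sub_of_add_eq hx
    have hy' := eq_sub_of_add_eq hy
    simp only [hf]
    rw [hx', hy']
    abel
  -- `f` is continuous on `S`
  have hcont : ∀ (i : ℕ) (z : EuclideanSpace ℝ (Fin 3)),
      ContinuousOn (fun τ => Uw i τ z) (Ioo (-(i : ℝ) - 3) (-(i : ℝ))) :=
    fun i z => continuousOn_apply_family (hlip i) z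
  have hfc : ContinuousOn f S :=
    (((hcont j x).mono inter_subset_left).sub ((hcont j' x).mono inter_subset_right)).sub
      (((hcont j y).mono inter_subset_left).sub ((hcont j' y).mono inter_subset_right))
  have hEq := Measure.eqOn_open_of_ae_eq hf0 hSo hfc continuousOn_const
  have := hEq ⟨ht, ht'⟩
  simp only [hf] at this
  exact sub_eq_zero.1 this

/-- **Derivatives are intrinsic.** On the common good range of two windows the gradients of
`U_j(t, ·)` and `U_{j'}(t, ·)` agree (they differ by a constant). [folklore] -/
theorem overlap_fderiv_eq
    (hae : ∀ j : ℕ, ∀ᵐ t ∂((volume : Measure ℝ).restrict (Ioo (-(j : ℝ) - 4) (-(j : ℝ)))),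
      u t =ᵐ[volume] fun x => Uw j t x + bw j t)
    (hsm : ∀ j : ℕ, ∀ t ∈ Ioo (-(j : ℝ) - 4) (-(j : ℝ)), ContDiff ℝ ∞ (Uw j t))
    {L : ℕ → ℝ}
    (hlip : ∀ (j k : ℕ), ∀ s ∈ Ioo (-(j : ℝ) - 3) (-(j : ℝ)), ∀ t ∈ Ioo (-(j : ℝ) - 3) (-(j : ℝ)), ∀ x,
      ‖iteratedFDeriv ℝ k (Uw j t) x - iteratedFDeriv ℝ k (Uw j s) x‖ ≤ L k * |t - s|)
    {j j' : ℕ} {t : ℝ} (ht : t ∈ Ioo (-(j : ℝ) - 3) (-(j : ℝ)))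
    (ht' : t ∈ Ioo (-(j' : ℝ) - 3) (-(j' : ℝ))) :
    fderiv ℝ (Uw j t) = fderiv ℝ (Uw j' t) := by
  have hc : Uw j t = fun x => Uw j' t x + (Uw j t 0 - Uw j' t 0) := by
    funext x
    rw [← overlap_sub_eq hae hsm hlip ht ht' x 0]
    abel
  rw [hc]
  funext x
  exact fderiv_add_const _

/-- Consequently the vorticities agree on the common good range. [folklore] -/
theorem overlap_curl_eq
    (hae : ∀ j : ℕ, ∀ᵐ t ∂((volume : Measure ℝ).restrict (Ioo (-(j : ℝ) - 4) (-(j : ℝ)))),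
      u t =ᵐ[volume] fun x => Uw j t x + bw j t)
    (hsm : ∀ j : ℕ, ∀ t ∈ Ioo (-(j : ℝ) - 4) (-(j : ℝ)), ContDiff ℝ ∞ (Uw j t))
    {L : ℕ → ℝ}
    (hlip : ∀ (j k : ℕ), ∀ s ∈ Ioo (-(j : ℝ) - 3) (-(j : ℝ)), ∀ t ∈ Ioo (-(j : ℝ) - 3) (-(j : ℝ)), ∀ x,
      ‖iteratedFDeriv ℝ k (Uw j t) x - iteratedFDeriv ℝ k (Uw j s) x‖ ≤ L k * |t - s|)
    {j j' : ℕ} {t : ℝ} (ht : t ∈ Ioo (-(j : ℝ) - 3) (-(j : ℝ)))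
    (ht' : t ∈ Ioo (-(j' : ℝ) - 3) (-(j' : ℝ))) :
    curl (Uw j t) = curl (Uw j' t) := by
  rw [curl_eq_curlCLM_comp, curl_eq_curlCLM_comp, overlap_fderiv_eq hae hsm hlip ht ht']

/-- Consequently all spatial derivatives of order `≥ 1` agree on the common good range. [folklore] -/
theorem overlap_iteratedFDeriv_succ_eq
    (hae : ∀ j : ℕ, ∀ᵐ t ∂((volume : Measure ℝ).restrict (Ioo (-(j : ℝ) - 4) (-(j : ℝ)))),
      u t =ᵐ[volume] fun x => Uw j t x + bw j t)
    (hsm : ∀ j : ℕ, ∀ t ∈ Ioo (-(j : ℝ) - 4) (-(j : ℝ)), ContDiff ℝ ∞ (Uw j t))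
    {L : ℕ → ℝ}
    (hlip : ∀ (j k : ℕ), ∀ s ∈ Ioo (-(j : ℝ) - 3) (-(j : ℝ)), ∀ t ∈ Ioo (-(j : ℝ) - 3) (-(j : ℝ)), ∀ x,
      ‖iteratedFDeriv ℝ k (Uw j t) x - iteratedFDeriv ℝ k (Uw j s) x‖ ≤ L k * |t - s|)
    {j j' : ℕ} {t : ℝ} (ht : t ∈ Ioo (-(j : ℝ) - 3) (-(j : ℝ)))
    (ht' : t ∈ Ioo (-(j' : ℝ) - 3) (-(j' : ℝ))) (n : ℕ) (x : EuclideanSpace ℝ (Fin 3)) :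
    iteratedFDeriv ℝ (n + 1) (Uw j t) x = iteratedFDeriv ℝ (n + 1) (Uw j' t) x := by
  rw [iteratedFDeriv_succ_eq_comp_right, iteratedFDeriv_succ_eq_comp_right]
  have hF := overlap_fderiv_eq hae hsm hlip ht ht'
  simp only [Function.comp_apply, hF]

/-- **Smoothness, divergence and derivative bounds of the glued field** transfer from the
windows, since `ι` selects a window in whose good range `t` lies. [folklore] -/
theorem glue_pointwise
    (hsm : ∀ j : ℕ, ∀ t ∈ Ioo (-(j : ℝ) - 4) (-(j : ℝ)), ContDiff ℝ ∞ (Uw j t))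
    (hdf : ∀ j : ℕ, ∀ t ∈ Ioo (-(j : ℝ) - 4) (-(j : ℝ)), VectorCalculus.IsDivFree (Uw j t))
    {C : ℕ → ℝ}
    (hbd : ∀ (j k : ℕ), ∀ t ∈ Ioo (-(j : ℝ) - 3) (-(j : ℝ)), ∀ x, ‖iteratedFDeriv ℝ k (Uw j t) x‖ ≤ C k)
    (hι : ∀ t < 0, -(ι t : ℝ) - 1 ≤ t ∧ t < -(ι t : ℝ)) :
    (∀ t < 0, ContDiff ℝ ∞ (Uw (ι t) t)) ∧ (∀ t < 0, VectorCalculus.IsDivFree (Uw (ι t) t)) ∧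
      ∀ k : ℕ, ∀ t < 0, ∀ x, ‖iteratedFDeriv ℝ k (Uw (ι t) t) x‖ ≤ C k := by
  have hW : ∀ t < 0, t ∈ Ioo (-(ι t : ℝ) - 4) (-(ι t : ℝ)) := fun t ht =>
    ⟨by linarith [(hι t ht).1], (hι t ht).2⟩
  have hG : ∀ t < 0, t ∈ Ioo (-(ι t : ℝ) - 3) (-(ι t : ℝ)) := fun t ht =>
    ⟨by linarith [(hι t ht).1], (hι t ht).2⟩
  exact ⟨fun t ht => hsm _ t (hW t ht), fun t ht => hdf _ t (hW t ht),
    fun k t ht x => hbd _ k t (hG t ht) x⟩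

/-- **The derivatives of order `≥ 1` of the glued field are Lipschitz in time on all of
`(−∞, 0)`**: nearby times lie in a common good range, where the derivatives are intrinsic
(`overlap_iteratedFDeriv_succ_eq`) and Lipschitz; distant times (`|t − s| ≥ 1`) are handled by
the uniform bound. [folklore] -/
theorem glue_lipschitz
    (hae : ∀ j : ℕ, ∀ᵐ t ∂((volume : Measure ℝ).restrict (Ioo (-(j : ℝ) - 4) (-(j : ℝ)))),
      u t =ᵐ[volume] fun x => Uw j t x + bw j t)
    (hsm : ∀ j : ℕ, ∀ t ∈ Ioo (-(j : ℝ) - 4) (-(j : ℝ)), ContDiff ℝ ∞ (Uw j t))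
    {C L : ℕ → ℝ}
    (hbd : ∀ (j k : ℕ), ∀ t ∈ Ioo (-(j : ℝ) - 3) (-(j : ℝ)), ∀ x, ‖iteratedFDeriv ℝ k (Uw j t) x‖ ≤ C k)
    (hlip : ∀ (j k : ℕ), ∀ s ∈ Ioo (-(j : ℝ) - 3) (-(j : ℝ)), ∀ t ∈ Ioo (-(j : ℝ) - 3) (-(j : ℝ)), ∀ x,
      ‖iteratedFDeriv ℝ k (Uw j t) x - iteratedFDeriv ℝ k (Uw j s) x‖ ≤ L k * |t - s|)
    (hι : ∀ t < 0, -(ι t : ℝ) - 1 ≤ t ∧ t < -(ι t : ℝ)) {k : ℕ} (hk : 1 ≤ k) :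
    ∀ s < 0, ∀ t < 0, ∀ x, ‖iteratedFDeriv ℝ k (Uw (ι t) t) x - iteratedFDeriv ℝ k (Uw (ι s) s) x‖ ≤
      max (L k) (2 * C k) * |t - s| := by
  obtain ⟨n, rfl⟩ : ∃ n, k = n + 1 := ⟨k - 1, by omega⟩
  have hG : ∀ t < 0, t ∈ Ioo (-(ι t : ℝ) - 3) (-(ι t : ℝ)) := fun t ht =>
    ⟨by linarith [(hι t ht).1], (hι t ht).2⟩
  have hC : 0 ≤ C (n + 1) :=
    (norm_nonneg _).trans (hbd (ι (-1)) (n + 1) (-1) (hG (-1) (by norm_num)) 0)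
  -- the case `s ≤ t`
  have key : ∀ s t : ℝ, s ≤ t → s < 0 → t < 0 → ∀ x,
      ‖iteratedFDeriv ℝ (n + 1) (Uw (ι t) t) x - iteratedFDeriv ℝ (n + 1) (Uw (ι s) s) x‖ ≤
        max (L (n + 1)) (2 * C (n + 1)) * |t - s| := by
    intro s t hst hs ht x
    rcases lt_or_ge (t - s) 1 with hclose | hfar
    · -- both `s` and `t` lie in the good range of the window `ι t`
      have hsG : s ∈ Ioo (-(ι t : ℝ) - 3) (-(ι t : ℝ)) :=
        ⟨by linarith [(hι t ht).1], by linarith [(hι t ht).2]⟩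
      rw [overlap_iteratedFDeriv_succ_eq hae hsm hlip (hG s hs) hsG n x]
      calc ‖iteratedFDeriv ℝ (n + 1) (Uw (ι t) t) x - iteratedFDeriv ℝ (n + 1) (Uw (ι t) s) x‖
          ≤ L (n + 1) * |t - s| := hlip (ι t) (n + 1) s hsG t (hG t ht) x
        _ ≤ max (L (n + 1)) (2 * C (n + 1)) * |t - s| := by
            gcongr
            exact le_max_left _ _
    · have h1 : 1 ≤ |t - s| := by rw [abs_of_nonneg (by linarith)]; exact hfar
      calc ‖iteratedFDeriv ℝ (n + 1) (Uw (ι t) t) x - iteratedFDeriv ℝ (n + 1) (Uw (ι s) s) x‖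
          ≤ ‖iteratedFDeriv ℝ (n + 1) (Uw (ι t) t) x‖ + ‖iteratedFDeriv ℝ (n + 1) (Uw (ι s) s) x‖ :=
            norm_sub_le _ _
        _ ≤ C (n + 1) + C (n + 1) :=
            add_le_add (hbd _ _ t (hG t ht) x) (hbd _ _ s (hG s hs) x)
        _ = 2 * C (n + 1) * 1 := by ring
        _ ≤ max (L (n + 1)) (2 * C (n + 1)) * |t - s| :=
            mul_le_mul (le_max_right _ _) h1 zero_le_one
              (le_trans (by positivity) (le_max_right _ _))
  intro s hs t ht x
  rcases le_total s t with hst | hts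
  · exact key s t hst hs ht x
  · rw [norm_sub_rev, abs_sub_comm]
    exact key t s hts ht hs x


end Gluing


end Literature.Analysis.FluidPDE

end
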